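import Summits.CriticalPhenomena.SAWScalingLimit.Theorems.SAWTotalPositivityBoundaryTP2Strip4EndA
import Summits.CriticalPhenomena.SAWScalingLimit.Theorems.SAWTotalPositivityBoundaryTP2StripCertW4EndDirect
import Summits.CriticalPhenomena.SAWScalingLimit.Theorems.SAWTotalPositivityBoundaryTP2Strip4SectorTraj
import Summits.CriticalPhenomena.SAWScalingLimit.Theorems.SAWTotalPositivityBoundaryTP2Strip4Table
import HarnessLib

/-!
# Crux `BoundaryTP2` (stmt-CriticalPhenomena-7115), line `Sketch`: END-PAIR labelling on the 4-row strips, part B — the thirteen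
end-pair forms in the letters for the lengths `n = 1, 2` (exact end kernels) (lead c6)

Bookkeeping lemmas `endForms_of_certs` / `endForms_of_bounds`, and `strip4_endForms_head1/2`: the direct kernel checks of
`StripCert` part 9b read back through the sector trajectories and the kernel table. [folklore]
-/

noncomputable section

namespace Summit.CriticalPhenomena.SAWScalingLimit.Theorems.BoundaryTP2

open Literature.Probability.LatticeModels Literature.Probability.RandomPlanarGeometry
open Summit.CriticalPhenomena.SAWScalingLimit.Theorems.EdgeOfPositivity.Negative
open Summit.CriticalPhenomena.SAWScalingLimit.Theorems.BoundaryTP2.Negative.Cert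
open Summit.CriticalPhenomena.SAWScalingLimit.Theorems.BoundaryTP2.StripCert
open scoped ENNReal

/-! ## §24 The thirteen end-pair forms in the letters -/

/-- Bookkeeping: from the certified forms `4 E E' - (2ℓ)(2ℓ') ≥ 0` against table values `E ≤ F` (the actual end kernels)
to `ℓ ℓ' ≤ F F'`. [folklore] -/
theorem endForms_of_certs {b c d e f E01 E02 E03 E12 F01 F02 F03 F12 : ℝ}
    (e01 : 0 ≤ E01) (e02 : 0 ≤ E02) (e03 : 0 ≤ E03) (e12 : 0 ≤ E12)
    (h01 : E01 ≤ F01) (h02 : E02 ≤ F02) (h03 : E03 ≤ F03) (h12 : E12 ≤ F12)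
    (c0 : 0 ≤ 4 * (E01 * E01) - (2 * b) * (2 * b)) (c1 : 0 ≤ 4 * (E01 * E02) - (2 * b) * (2 * c)) (c2 : 0 ≤ 4 * (E01 * E03) - (2 * b) * (2 * d)) (c3 : 0 ≤ 4 * (E01 * E12) - (2 * c) * (2 * e)) (c4 : 0 ≤ 4 * (E01 * E02) - (2 * d) * (2 * e)) (c5 : 0 ≤ 4 * (E01 * E01) - (2 * d) * (2 * f)) (c6 : 0 ≤ 4 * (E02 * E02) - (2 * c) * (2 * c)) (c7 : 0 ≤ 4 * (E02 * E03) - (2 * c) * (2 * d)) (c8 : 0 ≤ 4 * (E02 * E12) - (2 * c) * (2 * f)) (c9 : 0 ≤ 4 * (E02 * E02) - (2 * d) * (2 * f)) (c10 : 0 ≤ 4 * (E03 * E03) - (2 * d) * (2 * d)) (c11 : 0 ≤ 4 * (E03 * E12) - (2 * c) * (2 * c)) (c12 : 0 ≤ 4 * (E12 * E12) - (2 * f) * (2 * f)) :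
    b * b ≤ F01 * F01 ∧
    b * c ≤ F01 * F02 ∧
    b * d ≤ F01 * F03 ∧
    c * e ≤ F01 * F12 ∧
    d * e ≤ F01 * F02 ∧
    d * f ≤ F01 * F01 ∧
    c * c ≤ F02 * F02 ∧
    c * d ≤ F02 * F03 ∧
    c * f ≤ F02 * F12 ∧
    d * f ≤ F02 * F02 ∧
    d * d ≤ F03 * F03 ∧
    c * c ≤ F03 * F12 ∧
    f * f ≤ F12 * F12 := by
  refine ⟨?_, ?_, ?_, ?_, ?_, ?_, ?_, ?_, ?_, ?_, ?_, ?_, ?_⟩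
  · linarith only [c0, mul_le_mul h01 h01 e01 (le_trans e01 h01)]
  · linarith only [c1, mul_le_mul h01 h02 e02 (le_trans e01 h01)]
  · linarith only [c2, mul_le_mul h01 h03 e03 (le_trans e01 h01)]
  · linarith only [c3, mul_le_mul h01 h12 e12 (le_trans e01 h01)]
  · linarith only [c4, mul_le_mul h01 h02 e02 (le_trans e01 h01)]
  · linarith only [c5, mul_le_mul h01 h01 e01 (le_trans e01 h01)]
  · linarith only [c6, mul_le_mul h02 h02 e02 (le_trans e02 h02)]
  · linarith only [c7, mul_le_mul h02 h03 e03 (le_trans e02 h02)]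
  · linarith only [c8, mul_le_mul h02 h12 e12 (le_trans e02 h02)]
  · linarith only [c9, mul_le_mul h02 h02 e02 (le_trans e02 h02)]
  · linarith only [c10, mul_le_mul h03 h03 e03 (le_trans e03 h03)]
  · linarith only [c11, mul_le_mul h03 h12 e12 (le_trans e03 h03)]
  · linarith only [c12, mul_le_mul h12 h12 e12 (le_trans e12 h12)]

/-- Bookkeeping for the tail: letters below their bounds `ℓ ≤ Q_ℓ`, certified `E E' - Q Q' ≥ 0` against table values
`E ≤ F`. [folklore] -/
theorem endForms_of_bounds {b c d e f Q0 Q1 S1 E01 E02 E03 E12 F01 F02 F03 F12 : ℝ}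
    (nb : 0 ≤ b) (nc : 0 ≤ c) (nd : 0 ≤ d) (ne : 0 ≤ e) (nf : 0 ≤ f)
    (hlb : b ≤ Q1) (hlc : c ≤ Q1) (hld : d ≤ Q0) (hle : e ≤ S1) (hlf : f ≤ S1)
    (e01 : 0 ≤ E01) (e02 : 0 ≤ E02) (e03 : 0 ≤ E03) (e12 : 0 ≤ E12)
    (h01 : E01 ≤ F01) (h02 : E02 ≤ F02) (h03 : E03 ≤ F03) (h12 : E12 ≤ F12)
    (t0 : 0 ≤ E01 * E01 - Q1 * Q1) (t1 : 0 ≤ E01 * E02 - Q1 * Q1) (t2 : 0 ≤ E01 * E03 - Q1 * Q0) (t3 : 0 ≤ E01 * E12 - Q1 * S1) (t4 : 0 ≤ E01 * E02 - Q0 * S1) (t5 : 0 ≤ E01 * E01 - Q0 * S1) (t6 : 0 ≤ E02 * E02 - Q1 * Q1) (t7 : 0 ≤ E02 * E03 - Q1 * Q0) (t8 : 0 ≤ E02 * E12 - Q1 * S1) (t9 : 0 ≤ E02 * E02 - Q0 * S1) (t10 : 0 ≤ E03 * E03 - Q0 * Q0) (t11 : 0 ≤ E03 * E12 - Q1 *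 Q1) (t12 : 0 ≤ E12 * E12 - S1 * S1) :
    b * b ≤ F01 * F01 ∧
    b * c ≤ F01 * F02 ∧
    b * d ≤ F01 * F03 ∧
    c * e ≤ F01 * F12 ∧
    d * e ≤ F01 * F02 ∧
    d * f ≤ F01 * F01 ∧
    c * c ≤ F02 * F02 ∧
    c * d ≤ F02 * F03 ∧
    c * f ≤ F02 * F12 ∧
    d * f ≤ F02 * F02 ∧
    d * d ≤ F03 * F03 ∧
    c * c ≤ F03 * F12 ∧
    f * f ≤ F12 * F12 := by
  refine ⟨?_, ?_, ?_, ?_, ?_, ?_, ?_, ?_, ?_, ?_, ?_, ?_, ?_⟩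
  · linarith only [t0, mul_le_mul hlb hlb nb (le_trans nb hlb), mul_le_mul h01 h01 e01 (le_trans e01 h01)]
  · linarith only [t1, mul_le_mul hlb hlc nc (le_trans nb hlb), mul_le_mul h01 h02 e02 (le_trans e01 h01)]
  · linarith only [t2, mul_le_mul hlb hld nd (le_trans nb hlb), mul_le_mul h01 h03 e03 (le_trans e01 h01)]
  · linarith only [t3, mul_le_mul hlc hle ne (le_trans nc hlc), mul_le_mul h01 h12 e12 (le_trans e01 h01)]
  · linarith only [t4, mul_le_mul hld hle ne (le_trans nd hld), mul_le_mul h01 h02 e02 (le_trans e01 h01)]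
  · linarith only [t5, mul_le_mul hld hlf nf (le_trans nd hld), mul_le_mul h01 h01 e01 (le_trans e01 h01)]
  · linarith only [t6, mul_le_mul hlc hlc nc (le_trans nc hlc), mul_le_mul h02 h02 e02 (le_trans e02 h02)]
  · linarith only [t7, mul_le_mul hlc hld nd (le_trans nc hlc), mul_le_mul h02 h03 e03 (le_trans e02 h02)]
  · linarith only [t8, mul_le_mul hlc hlf nf (le_trans nc hlc), mul_le_mul h02 h12 e12 (le_trans e02 h02)]
  · linarith only [t9, mul_le_mul hld hlf nf (le_trans nd hld), mul_le_mul h02 h02 e02 (le_trans e02 h02)]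
  · linarith only [t10, mul_le_mul hld hld nd (le_trans nd hld), mul_le_mul h03 h03 e03 (le_trans e03 h03)]
  · linarith only [t11, mul_le_mul hlc hlc nc (le_trans nc hlc), mul_le_mul h03 h12 e12 (le_trans e03 h03)]
  · linarith only [t12, mul_le_mul hlf hlf nf (le_trans nf hlf), mul_le_mul h12 h12 e12 (le_trans e12 h12)]

set_option linter.unusedSimpArgs false in
/-- The thirteen end-pair forms at length `1` (exact end kernels of `S_1`). [folklore] -/
theorem strip4_endForms_head1 {x : ℝ} (hx1 : 1 / 3 ≤ x) (hx2 : x ≤ 5 / 13) :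
    (pathKernel (discreteDomainGraph (rectDomain 1 3) 1) x (st 0 0) (st 1 1)).toReal * (pathKernel (discreteDomainGraph (rectDomain 1 3) 1) x (st 0 0) (st 1 1)).toReal ≤
      (pathKernel (discreteDomainGraph (rectDomain 1 3) 1) x (st 0 0) (st 0 1)).toReal * (pathKernel (discreteDomainGraph (rectDomain 1 3) 1) x (st 0 0) (st 0 1)).toReal ∧
    (pathKernel (discreteDomainGraph (rectDomain 1 3) 1) x (st 0 0) (st 1 1)).toReal * (pathKernel (discreteDomainGraph (rectDomain 1 3) 1) x (st 0 0) (st 1 2)).toReal ≤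
      (pathKernel (discreteDomainGraph (rectDomain 1 3) 1) x (st 0 0) (st 0 1)).toReal * (pathKernel (discreteDomainGraph (rectDomain 1 3) 1) x (st 0 0) (st 0 2)).toReal ∧
    (pathKernel (discreteDomainGraph (rectDomain 1 3) 1) x (st 0 0) (st 1 1)).toReal * (pathKernel (discreteDomainGraph (rectDomain 1 3) 1) x (st 0 0) (st 1 3)).toReal ≤
      (pathKernel (discreteDomainGraph (rectDomain 1 3) 1) x (st 0 0) (st 0 1)).toReal * (pathKernel (discreteDomainGraph (rectDomain 1 3) 1) x (st 0 0) (st 0 3)).toReal ∧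
    (pathKernel (discreteDomainGraph (rectDomain 1 3) 1) x (st 0 0) (st 1 2)).toReal * (pathKernel (discreteDomainGraph (rectDomain 1 3) 1) x (st 0 1) (st 1 1)).toReal ≤
      (pathKernel (discreteDomainGraph (rectDomain 1 3) 1) x (st 0 0) (st 0 1)).toReal * (pathKernel (discreteDomainGraph (rectDomain 1 3) 1) x (st 0 1) (st 0 2)).toReal ∧
    (pathKernel (discreteDomainGraph (rectDomain 1 3) 1) x (st 0 0) (st 1 3)).toReal * (pathKernel (discreteDomainGraph (rectDomain 1 3) 1) x (st 0 1) (st 1 1)).toReal ≤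
      (pathKernel (discreteDomainGraph (rectDomain 1 3) 1) x (st 0 0) (st 0 1)).toReal * (pathKernel (discreteDomainGraph (rectDomain 1 3) 1) x (st 0 0) (st 0 2)).toReal ∧
    (pathKernel (discreteDomainGraph (rectDomain 1 3) 1) x (st 0 0) (st 1 3)).toReal * (pathKernel (discreteDomainGraph (rectDomain 1 3) 1) x (st 0 1) (st 1 2)).toReal ≤
      (pathKernel (discreteDomainGraph (rectDomain 1 3) 1) x (st 0 0) (st 0 1)).toReal * (pathKernel (discreteDomainGraph (rectDomain 1 3) 1) x (st 0 0) (st 0 1)).toReal ∧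
    (pathKernel (discreteDomainGraph (rectDomain 1 3) 1) x (st 0 0) (st 1 2)).toReal * (pathKernel (discreteDomainGraph (rectDomain 1 3) 1) x (st 0 0) (st 1 2)).toReal ≤
      (pathKernel (discreteDomainGraph (rectDomain 1 3) 1) x (st 0 0) (st 0 2)).toReal * (pathKernel (discreteDomainGraph (rectDomain 1 3) 1) x (st 0 0) (st 0 2)).toReal ∧
    (pathKernel (discreteDomainGraph (rectDomain 1 3) 1) x (st 0 0) (st 1 2)).toReal * (pathKernel (discreteDomainGraph (rectDomain 1 3) 1) x (st 0 0) (st 1 3)).toReal ≤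
      (pathKernel (discreteDomainGraph (rectDomain 1 3) 1) x (st 0 0) (st 0 2)).toReal * (pathKernel (discreteDomainGraph (rectDomain 1 3) 1) x (st 0 0) (st 0 3)).toReal ∧
    (pathKernel (discreteDomainGraph (rectDomain 1 3) 1) x (st 0 0) (st 1 2)).toReal * (pathKernel (discreteDomainGraph (rectDomain 1 3) 1) x (st 0 1) (st 1 2)).toReal ≤
      (pathKernel (discreteDomainGraph (rectDomain 1 3) 1) x (st 0 0) (st 0 2)).toReal * (pathKernel (discreteDomainGraph (rectDomain 1 3) 1) x (st 0 1) (st 0 2)).toReal ∧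
    (pathKernel (discreteDomainGraph (rectDomain 1 3) 1) x (st 0 0) (st 1 3)).toReal * (pathKernel (discreteDomainGraph (rectDomain 1 3) 1) x (st 0 1) (st 1 2)).toReal ≤
      (pathKernel (discreteDomainGraph (rectDomain 1 3) 1) x (st 0 0) (st 0 2)).toReal * (pathKernel (discreteDomainGraph (rectDomain 1 3) 1) x (st 0 0) (st 0 2)).toReal ∧
    (pathKernel (discreteDomainGraph (rectDomain 1 3) 1) x (st 0 0) (st 1 3)).toReal * (pathKernel (discreteDomainGraph (rectDomain 1 3) 1) x (st 0 0) (st 1 3)).toReal ≤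
      (pathKernel (discreteDomainGraph (rectDomain 1 3) 1) x (st 0 0) (st 0 3)).toReal * (pathKernel (discreteDomainGraph (rectDomain 1 3) 1) x (st 0 0) (st 0 3)).toReal ∧
    (pathKernel (discreteDomainGraph (rectDomain 1 3) 1) x (st 0 0) (st 1 2)).toReal * (pathKernel (discreteDomainGraph (rectDomain 1 3) 1) x (st 0 0) (st 1 2)).toReal ≤
      (pathKernel (discreteDomainGraph (rectDomain 1 3) 1) x (st 0 0) (st 0 3)).toReal * (pathKernel (discreteDomainGraph (rectDomain 1 3) 1) x (st 0 1) (st 0 2)).toReal ∧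
    (pathKernel (discreteDomainGraph (rectDomain 1 3) 1) x (st 0 1) (st 1 2)).toReal * (pathKernel (discreteDomainGraph (rectDomain 1 3) 1) x (st 0 1) (st 1 2)).toReal ≤
      (pathKernel (discreteDomainGraph (rectDomain 1 3) 1) x (st 0 1) (st 0 2)).toReal * (pathKernel (discreteDomainGraph (rectDomain 1 3) 1) x (st 0 1) (st 0 2)).toReal := by
  have hx0 : 0 ≤ x := by linarith
  obtain ⟨t10, t20, t30, t13, t21, t22, t23, t31, t32, t33⟩ := strip4_table 1 x
  obtain ⟨Up, hUp0, hUp, hUpd⟩ := strip4_evenTraj hx0 0 3 (Or.inl ⟨rfl, rfl⟩)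
  obtain ⟨Wp, hWp0, hWp, hWpd⟩ := strip4_evenTraj hx0 1 2 (Or.inr ⟨rfl, rfl⟩)
  obtain ⟨Uo, hUo0, hUo, hUod⟩ := strip4_oddTraj hx0 0 3 (Or.inl ⟨rfl, rfl⟩)
  obtain ⟨Wo, hWo0, hWo, hWod⟩ := strip4_oddTraj hx0 1 2 (Or.inr ⟨rfl, rfl⟩)
  simp only [if_pos] at hUp0 hUo0
  rw [if_neg (by norm_num)] at hWp0 hWo0
  -- letters
  have Lb : Up 1 1 + Uo 1 1 = 2 * (pathKernel (discreteDomainGraph (rectDomain 1 3) 1) x (st 0 0) (st 1 1)).toReal := by rw [(hUpd 1).2, (hUod 1).2, t31]; ring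
  have Lc : Up 1 1 - Uo 1 1 = 2 * (pathKernel (discreteDomainGraph (rectDomain 1 3) 1) x (st 0 0) (st 1 2)).toReal := by rw [(hUpd 1).2, (hUod 1).2, t31]; ring
  have Ld : Up 1 0 - Uo 1 0 = 2 * (pathKernel (discreteDomainGraph (rectDomain 1 3) 1) x (st 0 0) (st 1 3)).toReal := by rw [(hUpd 1).1, (hUod 1).1, t30]; ring
  have Le : Wp 1 1 + Wo 1 1 = 2 * (pathKernel (discreteDomainGraph (rectDomain 1 3) 1) x (st 0 1) (st 1 1)).toReal := by rw [(hWpd 1).2, (hWod 1).2, t21]; ring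
  have Lf : Wp 1 1 - Wo 1 1 = 2 * (pathKernel (discreteDomainGraph (rectDomain 1 3) 1) x (st 0 1) (st 1 2)).toReal := by rw [(hWpd 1).2, (hWod 1).2, t21]; ring
  have eU := traj_eq_evV_iterMV TeData 6 x ue0 hUp0 hUp 1
  have eW := traj_eq_evV_iterMV TeData 6 x we0 hWp0 hWp 1
  have eUo := traj_eq_evV_iterMV ToData 6 x uo0 hUo0 hUo 1
  have eWo := traj_eq_evV_iterMV ToData 6 x wo0 hWo0 hWo 1
  have c := fun q (hq : q < 13) => evZ_nonneg_on_enclosure (by norm_num) (cert_end1 q hq) hx1 hx2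
  obtain ⟨s0, s1, s2, s3, s4, s5, s6, s7, s8, s9, s10, s11, s12⟩ := evZ_endPolys1 1 x
  have c0 := c 0 (by norm_num)
  simp only [s0, ← eU 1 (by norm_num), ← eU 0 (by norm_num), ← eW 1 (by norm_num), ← eUo 1 (by norm_num),
    ← eUo 0 (by norm_num), ← eWo 1 (by norm_num), Lb, Lc, Ld, Le, Lf] at c0
  have c1 := c 1 (by norm_num)
  simp only [s1, ← eU 1 (by norm_num), ← eU 0 (by norm_num), ← eW 1 (by norm_num), ← eUo 1 (by norm_num),
    ← eUo 0 (by norm_num), ← eWo 1 (by norm_num), Lb, Lc, Ld, Le, Lf] at c1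
  have c2 := c 2 (by norm_num)
  simp only [s2, ← eU 1 (by norm_num), ← eU 0 (by norm_num), ← eW 1 (by norm_num), ← eUo 1 (by norm_num),
    ← eUo 0 (by norm_num), ← eWo 1 (by norm_num), Lb, Lc, Ld, Le, Lf] at c2
  have c3 := c 3 (by norm_num)
  simp only [s3, ← eU 1 (by norm_num), ← eU 0 (by norm_num), ← eW 1 (by norm_num), ← eUo 1 (by norm_num),
    ← eUo 0 (by norm_num), ← eWo 1 (by norm_num), Lb, Lc, Ld, Le, Lf] at c3
  have c4 := c 4 (by norm_num)
  simp only [s4, ← eU 1 (by norm_num), ← eU 0 (by norm_num), ← eW 1 (by norm_num), ← eUo 1 (by norm_num),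
    ← eUo 0 (by norm_num), ← eWo 1 (by norm_num), Lb, Lc, Ld, Le, Lf] at c4
  have c5 := c 5 (by norm_num)
  simp only [s5, ← eU 1 (by norm_num), ← eU 0 (by norm_num), ← eW 1 (by norm_num), ← eUo 1 (by norm_num),
    ← eUo 0 (by norm_num), ← eWo 1 (by norm_num), Lb, Lc, Ld, Le, Lf] at c5
  have c6 := c 6 (by norm_num)
  simp only [s6, ← eU 1 (by norm_num), ← eU 0 (by norm_num), ← eW 1 (by norm_num), ← eUo 1 (by norm_num),
    ← eUo 0 (by norm_num), ← eWo 1 (by norm_num), Lb, Lc, Ld, Le, Lf] at c6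
  have c7 := c 7 (by norm_num)
  simp only [s7, ← eU 1 (by norm_num), ← eU 0 (by norm_num), ← eW 1 (by norm_num), ← eUo 1 (by norm_num),
    ← eUo 0 (by norm_num), ← eWo 1 (by norm_num), Lb, Lc, Ld, Le, Lf] at c7
  have c8 := c 8 (by norm_num)
  simp only [s8, ← eU 1 (by norm_num), ← eU 0 (by norm_num), ← eW 1 (by norm_num), ← eUo 1 (by norm_num),
    ← eUo 0 (by norm_num), ← eWo 1 (by norm_num), Lb, Lc, Ld, Le, Lf] at c8
  have c9 := c 9 (by norm_num)
  simp only [s9, ← eU 1 (by norm_num), ← eU 0 (by norm_num), ← eW 1 (by norm_num), ← eUo 1 (by norm_num),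
    ← eUo 0 (by norm_num), ← eWo 1 (by norm_num), Lb, Lc, Ld, Le, Lf] at c9
  have c10 := c 10 (by norm_num)
  simp only [s10, ← eU 1 (by norm_num), ← eU 0 (by norm_num), ← eW 1 (by norm_num), ← eUo 1 (by norm_num),
    ← eUo 0 (by norm_num), ← eWo 1 (by norm_num), Lb, Lc, Ld, Le, Lf] at c10
  have c11 := c 11 (by norm_num)
  simp only [s11, ← eU 1 (by norm_num), ← eU 0 (by norm_num), ← eW 1 (by norm_num), ← eUo 1 (by norm_num),
    ← eUo 0 (by norm_num), ← eWo 1 (by norm_num), Lb, Lc, Ld, Le, Lf] at c11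
  have c12 := c 12 (by norm_num)
  simp only [s12, ← eU 1 (by norm_num), ← eU 0 (by norm_num), ← eW 1 (by norm_num), ← eUo 1 (by norm_num),
    ← eUo 0 (by norm_num), ← eWo 1 (by norm_num), Lb, Lc, Ld, Le, Lf] at c12
  -- the table values are (below) the end kernels at length 1
  have v01 := toReal_end_of_table (m := 1) (j := 0) (k := 1) (by norm_num) hx0 E1_01_eq
  have v02 := toReal_end_of_table (m := 1) (j := 0) (k := 2) (by norm_num) hx0 E1_02_eq
  have v03 := toReal_end_of_table (m := 1) (j := 0) (k := 3) (by norm_num) hx0 E1_03_eq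
  have v12 := toReal_end_of_table (m := 1) (j := 1) (k := 2) (by norm_num) hx0 E1_12_eq
  have e01 : 0 ≤ evZ E1_01 x := by rw [← v01]; exact ENNReal.toReal_nonneg
  have h01 : evZ E1_01 x ≤ (pathKernel (discreteDomainGraph (rectDomain 1 3) 1) x (st 0 0) (st 0 1)).toReal := (v01).symm.le
  have e02 : 0 ≤ evZ E1_02 x := by rw [← v02]; exact ENNReal.toReal_nonneg
  have h02 : evZ E1_02 x ≤ (pathKernel (discreteDomainGraph (rectDomain 1 3) 1) x (st 0 0) (st 0 2)).toReal := (v02).symm.le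
  have e03 : 0 ≤ evZ E1_03 x := by rw [← v03]; exact ENNReal.toReal_nonneg
  have h03 : evZ E1_03 x ≤ (pathKernel (discreteDomainGraph (rectDomain 1 3) 1) x (st 0 0) (st 0 3)).toReal := (v03).symm.le
  have e12 : 0 ≤ evZ E1_12 x := by rw [← v12]; exact ENNReal.toReal_nonneg
  have h12 : evZ E1_12 x ≤ (pathKernel (discreteDomainGraph (rectDomain 1 3) 1) x (st 0 1) (st 0 2)).toReal := (v12).symm.le

  exact endForms_of_certs e01 e02 e03 e12 h01 h02 h03 h12 c0 c1 c2 c3 c4 c5 c6 c7 c8 c9 c10 c11 c12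

set_option linter.unusedSimpArgs false in
/-- The thirteen end-pair forms at length `2` (exact end kernels of `S_2`). [folklore] -/
theorem strip4_endForms_head2 {x : ℝ} (hx1 : 1 / 3 ≤ x) (hx2 : x ≤ 5 / 13) :
    (pathKernel (discreteDomainGraph (rectDomain 2 3) 1) x (st 0 0) (st 2 1)).toReal * (pathKernel (discreteDomainGraph (rectDomain 2 3) 1) x (st 0 0) (st 2 1)).toReal ≤
      (pathKernel (discreteDomainGraph (rectDomain 2 3) 1) x (st 0 0) (st 0 1)).toReal * (pathKernel (discreteDomainGraph (rectDomain 2 3) 1) x (st 0 0) (st 0 1)).toReal ∧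
    (pathKernel (discreteDomainGraph (rectDomain 2 3) 1) x (st 0 0) (st 2 1)).toReal * (pathKernel (discreteDomainGraph (rectDomain 2 3) 1) x (st 0 0) (st 2 2)).toReal ≤
      (pathKernel (discreteDomainGraph (rectDomain 2 3) 1) x (st 0 0) (st 0 1)).toReal * (pathKernel (discreteDomainGraph (rectDomain 2 3) 1) x (st 0 0) (st 0 2)).toReal ∧
    (pathKernel (discreteDomainGraph (rectDomain 2 3) 1) x (st 0 0) (st 2 1)).toReal * (pathKernel (discreteDomainGraph (rectDomain 2 3) 1) x (st 0 0) (st 2 3)).toReal ≤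
      (pathKernel (discreteDomainGraph (rectDomain 2 3) 1) x (st 0 0) (st 0 1)).toReal * (pathKernel (discreteDomainGraph (rectDomain 2 3) 1) x (st 0 0) (st 0 3)).toReal ∧
    (pathKernel (discreteDomainGraph (rectDomain 2 3) 1) x (st 0 0) (st 2 2)).toReal * (pathKernel (discreteDomainGraph (rectDomain 2 3) 1) x (st 0 1) (st 2 1)).toReal ≤
      (pathKernel (discreteDomainGraph (rectDomain 2 3) 1) x (st 0 0) (st 0 1)).toReal * (pathKernel (discreteDomainGraph (rectDomain 2 3) 1) x (st 0 1) (st 0 2)).toReal ∧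
    (pathKernel (discreteDomainGraph (rectDomain 2 3) 1) x (st 0 0) (st 2 3)).toReal * (pathKernel (discreteDomainGraph (rectDomain 2 3) 1) x (st 0 1) (st 2 1)).toReal ≤
      (pathKernel (discreteDomainGraph (rectDomain 2 3) 1) x (st 0 0) (st 0 1)).toReal * (pathKernel (discreteDomainGraph (rectDomain 2 3) 1) x (st 0 0) (st 0 2)).toReal ∧
    (pathKernel (discreteDomainGraph (rectDomain 2 3) 1) x (st 0 0) (st 2 3)).toReal * (pathKernel (discreteDomainGraph (rectDomain 2 3) 1) x (st 0 1) (st 2 2)).toReal ≤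
      (pathKernel (discreteDomainGraph (rectDomain 2 3) 1) x (st 0 0) (st 0 1)).toReal * (pathKernel (discreteDomainGraph (rectDomain 2 3) 1) x (st 0 0) (st 0 1)).toReal ∧
    (pathKernel (discreteDomainGraph (rectDomain 2 3) 1) x (st 0 0) (st 2 2)).toReal * (pathKernel (discreteDomainGraph (rectDomain 2 3) 1) x (st 0 0) (st 2 2)).toReal ≤
      (pathKernel (discreteDomainGraph (rectDomain 2 3) 1) x (st 0 0) (st 0 2)).toReal * (pathKernel (discreteDomainGraph (rectDomain 2 3) 1) x (st 0 0) (st 0 2)).toReal ∧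
    (pathKernel (discreteDomainGraph (rectDomain 2 3) 1) x (st 0 0) (st 2 2)).toReal * (pathKernel (discreteDomainGraph (rectDomain 2 3) 1) x (st 0 0) (st 2 3)).toReal ≤
      (pathKernel (discreteDomainGraph (rectDomain 2 3) 1) x (st 0 0) (st 0 2)).toReal * (pathKernel (discreteDomainGraph (rectDomain 2 3) 1) x (st 0 0) (st 0 3)).toReal ∧
    (pathKernel (discreteDomainGraph (rectDomain 2 3) 1) x (st 0 0) (st 2 2)).toReal * (pathKernel (discreteDomainGraph (rectDomain 2 3) 1) x (st 0 1) (st 2 2)).toReal ≤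
      (pathKernel (discreteDomainGraph (rectDomain 2 3) 1) x (st 0 0) (st 0 2)).toReal * (pathKernel (discreteDomainGraph (rectDomain 2 3) 1) x (st 0 1) (st 0 2)).toReal ∧
    (pathKernel (discreteDomainGraph (rectDomain 2 3) 1) x (st 0 0) (st 2 3)).toReal * (pathKernel (discreteDomainGraph (rectDomain 2 3) 1) x (st 0 1) (st 2 2)).toReal ≤
      (pathKernel (discreteDomainGraph (rectDomain 2 3) 1) x (st 0 0) (st 0 2)).toReal * (pathKernel (discreteDomainGraph (rectDomain 2 3) 1) x (st 0 0) (st 0 2)).toReal ∧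
    (pathKernel (discreteDomainGraph (rectDomain 2 3) 1) x (st 0 0) (st 2 3)).toReal * (pathKernel (discreteDomainGraph (rectDomain 2 3) 1) x (st 0 0) (st 2 3)).toReal ≤
      (pathKernel (discreteDomainGraph (rectDomain 2 3) 1) x (st 0 0) (st 0 3)).toReal * (pathKernel (discreteDomainGraph (rectDomain 2 3) 1) x (st 0 0) (st 0 3)).toReal ∧
    (pathKernel (discreteDomainGraph (rectDomain 2 3) 1) x (st 0 0) (st 2 2)).toReal * (pathKernel (discreteDomainGraph (rectDomain 2 3) 1) x (st 0 0) (st 2 2)).toReal ≤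
      (pathKernel (discreteDomainGraph (rectDomain 2 3) 1) x (st 0 0) (st 0 3)).toReal * (pathKernel (discreteDomainGraph (rectDomain 2 3) 1) x (st 0 1) (st 0 2)).toReal ∧
    (pathKernel (discreteDomainGraph (rectDomain 2 3) 1) x (st 0 1) (st 2 2)).toReal * (pathKernel (discreteDomainGraph (rectDomain 2 3) 1) x (st 0 1) (st 2 2)).toReal ≤
      (pathKernel (discreteDomainGraph (rectDomain 2 3) 1) x (st 0 1) (st 0 2)).toReal * (pathKernel (discreteDomainGraph (rectDomain 2 3) 1) x (st 0 1) (st 0 2)).toReal := by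
  have hx0 : 0 ≤ x := by linarith
  obtain ⟨t10, t20, t30, t13, t21, t22, t23, t31, t32, t33⟩ := strip4_table 2 x
  obtain ⟨Up, hUp0, hUp, hUpd⟩ := strip4_evenTraj hx0 0 3 (Or.inl ⟨rfl, rfl⟩)
  obtain ⟨Wp, hWp0, hWp, hWpd⟩ := strip4_evenTraj hx0 1 2 (Or.inr ⟨rfl, rfl⟩)
  obtain ⟨Uo, hUo0, hUo, hUod⟩ := strip4_oddTraj hx0 0 3 (Or.inl ⟨rfl, rfl⟩)
  obtain ⟨Wo, hWo0, hWo, hWod⟩ := strip4_oddTraj hx0 1 2 (Or.inr ⟨rfl, rfl⟩)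
  simp only [if_pos] at hUp0 hUo0
  rw [if_neg (by norm_num)] at hWp0 hWo0
  -- letters
  have Lb : Up 2 1 + Uo 2 1 = 2 * (pathKernel (discreteDomainGraph (rectDomain 2 3) 1) x (st 0 0) (st 2 1)).toReal := by rw [(hUpd 2).2, (hUod 2).2, t31]; ring
  have Lc : Up 2 1 - Uo 2 1 = 2 * (pathKernel (discreteDomainGraph (rectDomain 2 3) 1) x (st 0 0) (st 2 2)).toReal := by rw [(hUpd 2).2, (hUod 2).2, t31]; ring
  have Ld : Up 2 0 - Uo 2 0 = 2 * (pathKernel (discreteDomainGraph (rectDomain 2 3) 1) x (st 0 0) (st 2 3)).toReal := by rw [(hUpd 2).1, (hUod 2).1, t30]; ring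
  have Le : Wp 2 1 + Wo 2 1 = 2 * (pathKernel (discreteDomainGraph (rectDomain 2 3) 1) x (st 0 1) (st 2 1)).toReal := by rw [(hWpd 2).2, (hWod 2).2, t21]; ring
  have Lf : Wp 2 1 - Wo 2 1 = 2 * (pathKernel (discreteDomainGraph (rectDomain 2 3) 1) x (st 0 1) (st 2 2)).toReal := by rw [(hWpd 2).2, (hWod 2).2, t21]; ring
  have eU := traj_eq_evV_iterMV TeData 6 x ue0 hUp0 hUp 2
  have eW := traj_eq_evV_iterMV TeData 6 x we0 hWp0 hWp 2
  have eUo := traj_eq_evV_iterMV ToData 6 x uo0 hUo0 hUo 2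
  have eWo := traj_eq_evV_iterMV ToData 6 x wo0 hWo0 hWo 2
  have c := fun q (hq : q < 13) => evZ_nonneg_on_enclosure (by norm_num) (cert_end2 q hq) hx1 hx2
  obtain ⟨s0, s1, s2, s3, s4, s5, s6, s7, s8, s9, s10, s11, s12⟩ := evZ_endPolys2 2 x
  have c0 := c 0 (by norm_num)
  simp only [s0, ← eU 1 (by norm_num), ← eU 0 (by norm_num), ← eW 1 (by norm_num), ← eUo 1 (by norm_num),
    ← eUo 0 (by norm_num), ← eWo 1 (by norm_num), Lb, Lc, Ld, Le, Lf] at c0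
  have c1 := c 1 (by norm_num)
  simp only [s1, ← eU 1 (by norm_num), ← eU 0 (by norm_num), ← eW 1 (by norm_num), ← eUo 1 (by norm_num),
    ← eUo 0 (by norm_num), ← eWo 1 (by norm_num), Lb, Lc, Ld, Le, Lf] at c1
  have c2 := c 2 (by norm_num)
  simp only [s2, ← eU 1 (by norm_num), ← eU 0 (by norm_num), ← eW 1 (by norm_num), ← eUo 1 (by norm_num),
    ← eUo 0 (by norm_num), ← eWo 1 (by norm_num), Lb, Lc, Ld, Le, Lf] at c2
  have c3 := c 3 (by norm_num)
  simp only [s3, ← eU 1 (by norm_num), ← eU 0 (by norm_num), ← eW 1 (by norm_num), ← eUo 1 (by norm_num),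
    ← eUo 0 (by norm_num), ← eWo 1 (by norm_num), Lb, Lc, Ld, Le, Lf] at c3
  have c4 := c 4 (by norm_num)
  simp only [s4, ← eU 1 (by norm_num), ← eU 0 (by norm_num), ← eW 1 (by norm_num), ← eUo 1 (by norm_num),
    ← eUo 0 (by norm_num), ← eWo 1 (by norm_num), Lb, Lc, Ld, Le, Lf] at c4
  have c5 := c 5 (by norm_num)
  simp only [s5, ← eU 1 (by norm_num), ← eU 0 (by norm_num), ← eW 1 (by norm_num), ← eUo 1 (by norm_num),
    ← eUo 0 (by norm_num), ← eWo 1 (by norm_num), Lb, Lc, Ld, Le, Lf] at c5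
  have c6 := c 6 (by norm_num)
  simp only [s6, ← eU 1 (by norm_num), ← eU 0 (by norm_num), ← eW 1 (by norm_num), ← eUo 1 (by norm_num),
    ← eUo 0 (by norm_num), ← eWo 1 (by norm_num), Lb, Lc, Ld, Le, Lf] at c6
  have c7 := c 7 (by norm_num)
  simp only [s7, ← eU 1 (by norm_num), ← eU 0 (by norm_num), ← eW 1 (by norm_num), ← eUo 1 (by norm_num),
    ← eUo 0 (by norm_num), ← eWo 1 (by norm_num), Lb, Lc, Ld, Le, Lf] at c7
  have c8 := c 8 (by norm_num)
  simp only [s8, ← eU 1 (by norm_num), ← eU 0 (by norm_num), ← eW 1 (by norm_num), ← eUo 1 (by norm_num),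
    ← eUo 0 (by norm_num), ← eWo 1 (by norm_num), Lb, Lc, Ld, Le, Lf] at c8
  have c9 := c 9 (by norm_num)
  simp only [s9, ← eU 1 (by norm_num), ← eU 0 (by norm_num), ← eW 1 (by norm_num), ← eUo 1 (by norm_num),
    ← eUo 0 (by norm_num), ← eWo 1 (by norm_num), Lb, Lc, Ld, Le, Lf] at c9
  have c10 := c 10 (by norm_num)
  simp only [s10, ← eU 1 (by norm_num), ← eU 0 (by norm_num), ← eW 1 (by norm_num), ← eUo 1 (by norm_num),
    ← eUo 0 (by norm_num), ← eWo 1 (by norm_num), Lb, Lc, Ld, Le, Lf] at c10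
  have c11 := c 11 (by norm_num)
  simp only [s11, ← eU 1 (by norm_num), ← eU 0 (by norm_num), ← eW 1 (by norm_num), ← eUo 1 (by norm_num),
    ← eUo 0 (by norm_num), ← eWo 1 (by norm_num), Lb, Lc, Ld, Le, Lf] at c11
  have c12 := c 12 (by norm_num)
  simp only [s12, ← eU 1 (by norm_num), ← eU 0 (by norm_num), ← eW 1 (by norm_num), ← eUo 1 (by norm_num),
    ← eUo 0 (by norm_num), ← eWo 1 (by norm_num), Lb, Lc, Ld, Le, Lf] at c12
  -- the table values are (below) the end kernels at length 2
  have v01 := toReal_end_of_table (m := 2) (j := 0) (k := 1) (by norm_num) hx0 E2_01_eq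
  have v02 := toReal_end_of_table (m := 2) (j := 0) (k := 2) (by norm_num) hx0 E2_02_eq
  have v03 := toReal_end_of_table (m := 2) (j := 0) (k := 3) (by norm_num) hx0 E2_03_eq
  have v12 := toReal_end_of_table (m := 2) (j := 1) (k := 2) (by norm_num) hx0 E2_12_eq
  have e01 : 0 ≤ evZ E2_01 x := by rw [← v01]; exact ENNReal.toReal_nonneg
  have h01 : evZ E2_01 x ≤ (pathKernel (discreteDomainGraph (rectDomain 2 3) 1) x (st 0 0) (st 0 1)).toReal := (v01).symm.le
  have e02 : 0 ≤ evZ E2_02 x := by rw [← v02]; exact ENNReal.toReal_nonneg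
  have h02 : evZ E2_02 x ≤ (pathKernel (discreteDomainGraph (rectDomain 2 3) 1) x (st 0 0) (st 0 2)).toReal := (v02).symm.le
  have e03 : 0 ≤ evZ E2_03 x := by rw [← v03]; exact ENNReal.toReal_nonneg
  have h03 : evZ E2_03 x ≤ (pathKernel (discreteDomainGraph (rectDomain 2 3) 1) x (st 0 0) (st 0 3)).toReal := (v03).symm.le
  have e12 : 0 ≤ evZ E2_12 x := by rw [← v12]; exact ENNReal.toReal_nonneg
  have h12 : evZ E2_12 x ≤ (pathKernel (discreteDomainGraph (rectDomain 2 3) 1) x (st 0 1) (st 0 2)).toReal := (v12).symm.le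

  exact endForms_of_certs e01 e02 e03 e12 h01 h02 h03 h12 c0 c1 c2 c3 c4 c5 c6 c7 c8 c9 c10 c11 c12

end Summit.CriticalPhenomena.SAWScalingLimit.Theorems.BoundaryTP2
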